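import Literature.NumberTheory.EllipticCurves.CongruenceVisibilityLocalFactors
import HarnessLib

/-!
# Visible elements of `Ш(E/K)[p]` from a `p`-congruent curve, III: the comparison of local conditions

`Proofs`-style file (theorems only: no definition, no named fact) in topic
`NumberTheory/EllipticCurves`, companion of `CongruenceVisibility.lean` /
`CongruenceVisibilityLocalFactors.lean` (the dimension count of Cremona–Mazur / Agashe–Stein for a
`Γ_K`-isomorphism `θ : E'[p] ≅ E[p]`, valid also at `p ∣ N`). Written for the cell `b2b-bsdres`
(run/shared/lean/b2b/bsd-rank1-residual/), whose HONEST FRAMING applies to its use there: the goal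
of that cell is to DELETE the COMBINATION-SHAPED residual classes for ALL analytic-rank `≤ 1`
elliptic curves over `ℚ` — "full BSD formula for every rank `≤ 1` curve in class C" assembled
STRICTLY from published theorems — so that the rank-`≤ 1` remainder becomes exactly the
CONSTRUCTION-SHAPED classes, which are TYPED (missing-input `Prop`s), NOT attempted; this is not
"finishing BSD". The theorems below refine ONE per-curve certificate shape (visibility); they are
general and cell-independent.

## What is refined

`WeierstrassCurve.exists_sha_ne_zero_of_congr_of_index_lt` asks the explaining classes to vanish
OUTRIGHT in `H¹(K_v, E'[p])` at the places `v ∈ S`, at the cost of the factor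
`#𝓛_v(E') = #E'(K_v)[p] · #(𝓞_v/p)` per place. This is wasteful whenever the local Kummer
conditions of `E` and `E'` at `v` CORRESPOND under `θ`: a class of `E'` that is Selmer at `v` then
transports to a class of `E` that is Selmer at `v`, with no loss at all. Writing
`𝓢_v(E) = selmerLocalKer W (K_v) p ≤ H¹(K, E[p])` for the global classes satisfying the local
Selmer condition of `E` at `v` (those dying in `H¹(K_v, E)`; `= res_v⁻¹ 𝓛_v(E)`,
`comap_res_kummerLocalConditionAt`) and `θ_* = h1Equiv θ`, the **comparison index at `v`** is

  `ι_v(θ) = [θ_* 𝓢_v(E') : θ_* 𝓢_v(E') ∩ 𝓢_v(E)]`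
  `= (selmerLocalKer W K_v p).relIndex ((selmerLocalKer W' K_v p).map θ_*)`.

* `relIndex_map_selmerLocalKer_ne_zero_and_le` — `1 ≤ ι_v(θ) ≤ #𝓛_v(E')` (classes restricting to
  zero at `v` transport into `𝓢_v(E)`, `h1Equiv_mem_selmerLocalKer_of_res_eq_zero`), so the count
  below is never worse than the one of `CongruenceVisibility.lean`;
* `exists_sha_ne_zero_of_congr_of_relIndex_lt` — **the refined count**: if
  `[E(K) : pE(K)] · ∏_{v ∈ S} ι_v(θ) < [E'(K) : pE'(K)]` then `Ш(E/K)` has a non-zero element killed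
  by `p` (same proof as the unrefined count, with `B = ⋂_{v ∈ S} (θ_* κ')⁻¹ 𝓢_v(E)` in place of
  `⋂ ker (res_v ∘ κ')`);
* `relIndex_map_selmerLocalKer_eq_one_iff` — `ι_v(θ) = 1 ↔ θ_* 𝓢_v(E') ≤ 𝓢_v(E)` ("the local
  conditions agree along `θ`", one inclusion suffices), and three sufficient criteria proved in the
  tree: both curves have good reduction at `v ∤ p` (`…_of_hasGoodReductionAt`: both conditions are
  "unramified at `v`", Gross 1991 (7.1), tree `selmerLocalKer_eq_unramifiedKer`, and unramifiedness
  passes through `θ`); `E'` has good reduction at `v ∤ p` and the unramified classes of `E[p]` at `v`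
  satisfy the local condition of `E` (`…_of_unramifiedKer_le`, the shape met for a level-RAISED
  partner); `#𝓛_v(E') = 1` (`…_of_natCard_eq_one`, e.g. `v ∤ p` and `E'(K_v)[p] = 0`). A fourth
  criterion — both curves with split multiplicative reduction at `v` (ANY `v`, also `v ∣ p`) — needs
  Tate's uniformisation and is the object of the companion file
  `CongruenceVisibilityMultiplicative.lean`;
* `exists_sha_ne_zero_of_congr_of_le_off` — the hybrid count: agreement at the places of `S \ T`,
  the crude factor `#𝓛_v(E')` at the places of `T`;
* `exists_sha_ne_zero_of_congr_of_rank_of_le` — the shape met in practice: `E(K)` finite of order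
  prime to `p`, agreement at every place of `S` above `p` and at every place of `S` where
  `E'(K_v)[p] ≠ 0`, and **`rank E'(K) ≥ 1`** ⇒ `Ш(E/K)[p] ≠ 0` (compare
  `exists_sha_ne_zero_of_congr_of_rank`: no `K_v`-rational `p`-torsion anywhere on `S` and
  `rank E'(K) ≥ [K:ℚ] + 1`).

## Provenance

The refined count is the elementary half of the comparison of two Selmer structures on one Galois
module: B. Mazur, K. Rubin, *Kolyvagin systems*, Mem. AMS 799 (2004), §2.3 (comparison of Selmer
groups for Selmer structures `𝓕 ≤ 𝓖`: `[H¹_𝓖 : H¹_𝓕] ≤ ∏_v [𝓖_v : 𝓕_v]`); B. Mazur, K. Rubin,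
*Ranks of twists of elliptic curves and Hilbert's tenth problem*, Invent. Math. 181 (2010),
Lemma 3.2 / Prop. 1.3 (the same count for quadratic twists `E`, `E^χ`, whose `E[2] = E^χ[2]`); for
visibility proper J. E. Cremona, B. Mazur, Experiment. Math. 9 (2000) §3 and A. Agashe, W. Stein,
J. Number Theory 97 (2002) Thm. 3.1, whose local analysis (§3.5) IS a proof that `ι_v = 1` at every
place under their hypotheses (component groups at `v ∤ p`, abelian reduction and `e < p − 1` at
`v ∣ p`). The intermediate statement with the indices `ι_v(θ)` as they stand — so that each place
can be treated by whichever criterion applies, in particular at `p ∣ N` — is folklore; we know no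
numbered printed statement of it and PROVE it here from the tree's Galois-cohomology library (no
named fact is used; inputs as in `CongruenceVisibility.lean`).

## References

* [CremonaMazur2000] J. E. Cremona, B. Mazur, *Visualizing elements in the Shafarevich–Tate
  group*, Experiment. Math. 9 (2000) 13–28, §3.
* [AgasheStein2002] A. Agashe, W. Stein, *Visibility of Shafarevich–Tate groups of abelian
  varieties*, J. Number Theory 97 (2002) 171–185, Thm. 3.1 and §3.5.
* [MazurRubin2004] B. Mazur, K. Rubin, *Kolyvagin systems*, Mem. Amer. Math. Soc. 799 (2004), §2.3.
* B. Mazur, K. Rubin, *Ranks of twists of elliptic curves and Hilbert's tenth problem*, Invent.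
  Math. 181 (2010), Lemma 3.2.
* [GrossLMS1991] B. H. Gross, *Kolyvagin's work on modular elliptic curves*, LMS LN 153 (1991), (7.1).
* [MilneADT2006] J. S. Milne, *Arithmetic Duality Theorems*, 2nd ed., I Lemma 3.3, Prop. 3.8.
-/

noncomputable section

open scoped Classical

namespace WeierstrassCurve

open Literature.NumberTheory.EllipticCurves Literature.NumberTheory.GaloisRepresentations Field
open NumberField IsDedekindDomain

section Main

variable {K : Type} [Field K] [NumberField K] (W W' : WeierstrassCurve K) [W.IsElliptic]
  [W'.IsElliptic] {p : ℕ} [Fact p.Prime]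

/-! ### The comparison index `ι_v(θ)` is a positive integer `≤ #𝓛_v(E')` -/

omit [W.IsElliptic] in
/-- **`1 ≤ ι_v(θ) ≤ #𝓛_v(E')`.** For a `Γ_K`-isomorphism `θ : E'[p] ≅ E[p]` and a finite place `v`,
the comparison index `ι_v(θ) = [θ_* 𝓢_v(E') : θ_* 𝓢_v(E') ∩ 𝓢_v(E)]` of the local Selmer
conditions (`𝓢_v(·) = selmerLocalKer · K_v p`, `θ_* = h1Equiv θ`) is non-zero and at most the
order of the local Kummer condition `𝓛_v(E') ≤ H¹(K_v, E'[p])`: the classes of `θ_* 𝓢_v(E')` whose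
pull-back restricts to ZERO at `v` lie in `𝓢_v(E)` (`h1Equiv_mem_selmerLocalKer_of_res_eq_zero`),
and they form the kernel of a homomorphism `θ_* 𝓢_v(E') → 𝓛_v(E')` (restriction at `v`;
`𝓢_v(E') = res_v⁻¹ 𝓛_v(E')`, `comap_res_kummerLocalConditionAt`; `𝓛_v(E')` is finite,
`finite_kummerLocalConditionAt_adicCompletion`). [folklore] -/
theorem relIndex_map_selmerLocalKer_ne_zero_and_le
    (θ : geomTorsion W' (p : ℤ) ≃+ geomTorsion W (p : ℤ))
    (hθ : ∀ (σ : absoluteGaloisGroup K) (P : geomTorsion W' (p : ℤ)), θ (σ • P) = σ • θ P)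
    (v : HeightOneSpectrum (𝓞 K)) :
    (selmerLocalKer W (v.adicCompletion K) (p : ℤ)).relIndex
        ((selmerLocalKer W' (v.adicCompletion K) (p : ℤ)).map (h1Equiv θ hθ).toAddMonoidHom) ≠ 0 ∧
      (selmerLocalKer W (v.adicCompletion K) (p : ℤ)).relIndex
          ((selmerLocalKer W' (v.adicCompletion K) (p : ℤ)).map (h1Equiv θ hθ).toAddMonoidHom) ≤
        Nat.card (W'.kummerLocalConditionAt (p : ℤ) (v.adicCompletion K)) := by
  have hp : p.Prime := Fact.out
  set A : AddSubgroup (galH1Torsion W (p : ℤ)) :=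
    (selmerLocalKer W' (v.adicCompletion K) (p : ℤ)).map (h1Equiv θ hθ).toAddMonoidHom with hA
  set Hs : AddSubgroup (galH1Torsion W (p : ℤ)) := selmerLocalKer W (v.adicCompletion K) (p : ℤ)
    with hHs
  -- `r = res_v ∘ θ_*⁻¹ : H¹(K, E[p]) → H¹(K_v, E'[p])`, with kernel `H₀ ≤ 𝓢_v(E)`
  set r : galH1Torsion W (p : ℤ) →+
      galoisCohomology (GaloisRep.restrictField (v.adicCompletion K)
        (W'.torsionGaloisModule (p : ℤ))) 1 :=
    (galoisCohomology.res (W'.torsionGaloisModule (p : ℤ)) (v.adicCompletion K) 1).comp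
      (h1Equiv θ hθ).symm.toAddMonoidHom with hr
  have hr_apply : ∀ c, r c = galoisCohomology.res (W'.torsionGaloisModule (p : ℤ))
      (v.adicCompletion K) 1 ((h1Equiv θ hθ).symm c) := fun c ↦ rfl
  set H₀ : AddSubgroup (galH1Torsion W (p : ℤ)) := r.ker with hH₀
  have hH₀le : H₀ ≤ Hs := by
    intro c hc
    rw [hH₀, AddMonoidHom.mem_ker, hr_apply] at hc
    have h := h1Equiv_mem_selmerLocalKer_of_res_eq_zero W W' θ hθ (v.adicCompletion K)
      ((h1Equiv θ hθ).symm c) hc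
    rwa [AddEquiv.apply_symm_apply] at h
  have hdvd : Hs.relIndex A ∣ H₀.relIndex A := AddSubgroup.relIndex_dvd_of_le_left A hH₀le
  -- `[A : A ∩ H₀] = # r(A)` and `r(A) ≤ 𝓛_v(E')`
  have hker : H₀.addSubgroupOf A = (r.comp A.subtype).ker := by
    rw [AddSubgroup.addSubgroupOf, hH₀, AddMonoidHom.comap_ker]
  have hidx : H₀.relIndex A = Nat.card (r.comp A.subtype).range := by
    rw [AddSubgroup.relIndex, hker, AddSubgroup.index_ker]
  have hrange : (r.comp A.subtype).range ≤ W'.kummerLocalConditionAt (p : ℤ) (v.adicCompletion K) := by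
    rintro _ ⟨⟨a, ha⟩, rfl⟩
    obtain ⟨c', hc', rfl⟩ := AddSubgroup.mem_map.mp ha
    rw [← comap_res_kummerLocalConditionAt] at hc'
    have e : (r.comp A.subtype) ⟨_, ha⟩ =
        galoisCohomology.res (W'.torsionGaloisModule (p : ℤ)) (v.adicCompletion K) 1 c' := by
      show r ((h1Equiv θ hθ).toAddMonoidHom c') = _
      rw [hr_apply]
      congr 1
      exact (h1Equiv θ hθ).symm_apply_apply c'
    rw [e]
    exact hc'
  haveI hfin : Finite (W'.kummerLocalConditionAt (p : ℤ) (v.adicCompletion K)) :=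
    W'.finite_kummerLocalConditionAt_adicCompletion v hp.ne_zero
  haveI : Finite (r.comp A.subtype).range :=
    Finite.of_injective _ (AddSubgroup.inclusion_injective hrange)
  have hle : H₀.relIndex A ≤ Nat.card (W'.kummerLocalConditionAt (p : ℤ) (v.adicCompletion K)) := by
    rw [hidx]
    exact Nat.card_le_card_of_injective _ (AddSubgroup.inclusion_injective hrange)
  have hne : H₀.relIndex A ≠ 0 := by
    rw [hidx]
    exact Nat.card_pos.ne'
  refine ⟨fun h0 ↦ ?_, (Nat.le_of_dvd (Nat.pos_of_ne_zero hne) hdvd).trans hle⟩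
  rw [h0, zero_dvd_iff] at hdvd
  exact hne hdvd

/-! ### The refined count -/

/-- **Visible elements of `Ш(E/K)[p]` from a `p`-congruent curve: the count with COMPARISON
indices.** Let `E = W`, `E' = W'` be elliptic curves over a number field `K`, `p` an odd prime,
`θ : E'[p] ≃ E[p]` a `Γ_K`-equivariant isomorphism with transport `θ_*` on `H¹(K, ·)`, and `S` a
finite set of finite places containing every place of bad reduction of `E` or `E'` and every place
above `p`. For `v ∈ S` let `ι_v(θ) = [θ_* 𝓢_v(E') : θ_* 𝓢_v(E') ∩ 𝓢_v(E)]`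
(`𝓢_v(·) = selmerLocalKer · K_v p`, the global classes satisfying the local Selmer condition at
`v`). **If `[E(K) : pE(K)] · ∏_{v ∈ S} ι_v(θ) < [E'(K) : pE'(K)]` then `Ш(E/K)` has a non-zero
element killed by `p`.** Since `ι_v(θ) ≤ #𝓛_v(E')`
(`relIndex_map_selmerLocalKer_ne_zero_and_le`) this sharpens
`exists_sha_ne_zero_of_congr_of_index_lt`; `ι_v(θ) = 1` as soon as the local conditions of `E'`
and `E` at `v` correspond under `θ` (`relIndex_map_selmerLocalKer_eq_one_iff` and the criteria
after it). Proof: with the Kummer maps `κ, κ'`, `f = (H¹(K,E[p]) → H¹(K,E)) ∘ θ_* ∘ κ'`,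
`B = ⋂_{v ∈ S} (θ_* ∘ κ')⁻¹ 𝓢_v(E)` (index `≤ ∏ ι_v(θ)`, as `κ'(E'(K)) ≤ 𝓢_v(E')`) and
`C = ker f ⊇ pE'(K)` (`[C : pE'(K)] ≤ [E(K) : pE(K)]`), the hypothesis gives `P ∈ B \ C`; then
`c = f(P) ≠ 0`, `pc = 0`, and `c ∈ Ш(E/K)`: at `v ∈ S` by the definition of `B`, at `v ∉ S`
because both local conditions are "unramified" there, at `v ∣ ∞` because `p` is odd.
[cite: CremonaMazur2000, §3 pp. 19–22] [cite: AgasheStein2002, Thm. 3.1 and §3.5]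
[cite: MazurRubin2004, §2.3] -/
theorem exists_sha_ne_zero_of_congr_of_relIndex_lt (hp2 : p ≠ 2)
    (θ : geomTorsion W' (p : ℤ) ≃+ geomTorsion W (p : ℤ))
    (hθ : ∀ (σ : absoluteGaloisGroup K) (P : geomTorsion W' (p : ℤ)), θ (σ • P) = σ • θ P)
    (S : Finset (HeightOneSpectrum (𝓞 K)))
    (hS : ∀ v : HeightOneSpectrum (𝓞 K), v ∉ S →
      W.HasGoodReductionAt v ∧ W'.HasGoodReductionAt v ∧ (p : 𝓞 K) ∉ v.asIdeal)
    (hlt : (zsmulAddGroupHom (p : ℤ) : W.toAffine.Point →+ W.toAffine.Point).range.index *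
        ∏ v ∈ S, (selmerLocalKer W (v.adicCompletion K) (p : ℤ)).relIndex
          ((selmerLocalKer W' (v.adicCompletion K) (p : ℤ)).map (h1Equiv θ hθ).toAddMonoidHom) <
      (zsmulAddGroupHom (p : ℤ) : W'.toAffine.Point →+ W'.toAffine.Point).range.index) :
    ∃ c : W.sha, c ≠ 0 ∧ p • c = 0 := by
  have hp : p.Prime := Fact.out
  have hn : (p : ℤ) ≠ 0 := by exact_mod_cast hp.ne_zero
  have hdiv : ∀ P : geomPoints W, ∃ Q : geomPoints W, (p : ℤ) • Q = P :=
    W.zsmul_geomPoints_surjective_holds hn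
  have hdiv' : ∀ P : geomPoints W', ∃ Q : geomPoints W', (p : ℤ) • Q = P :=
    W'.zsmul_geomPoints_surjective_holds hn
  -- the Kummer maps of `E` and `E'`, the visibility map `f : E'(K) → H¹(K, E)` and the local data
  set κ := kummerMapTorsion W (p : ℤ) hdiv with hκ
  set κ' := kummerMapTorsion W' (p : ℤ) hdiv' with hκ'
  set θκ' : W'.toAffine.Point →+ galH1Torsion W (p : ℤ) :=
    (h1Equiv θ hθ).toAddMonoidHom.comp κ' with hθκ'
  have hθκ'_apply : ∀ P, θκ' P = h1Equiv θ hθ (κ' P) := fun P ↦ rfl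
  set f : W'.toAffine.Point →+ W.galH1 := (torsionH1ToH1 W (p : ℤ)).comp θκ' with hf
  have hf_apply : ∀ P, f P = torsionH1ToH1 W (p : ℤ) (h1Equiv θ hθ (κ' P)) := fun P ↦ rfl
  set D : ∀ v : HeightOneSpectrum (𝓞 K), AddSubgroup W'.toAffine.Point :=
    fun v ↦ (selmerLocalKer W (v.adicCompletion K) (p : ℤ)).comap θκ' with hD
  have hD_mem : ∀ v P, P ∈ D v ↔
      h1Equiv θ hθ (κ' P) ∈ selmerLocalKer W (v.adicCompletion K) (p : ℤ) := fun v P ↦ Iff.rfl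
  set B : AddSubgroup W'.toAffine.Point := ⨅ v : S, D v with hB
  set C : AddSubgroup W'.toAffine.Point := f.ker with hC
  -- the Kummer image of `E(K)` is finite, of order `[E(K) : pE(K)]`
  have hκle : κ.range ≤ W.selmerGroup (p : ℤ) := by
    rintro _ ⟨P, rfl⟩
    exact (mem_selmerGroup_iff W _ _).mpr
      ⟨fun v ↦ kummerMapTorsion_mem_selmerLocalKer W _ hdiv _ P,
        fun w ↦ kummerMapTorsion_mem_selmerLocalKer W _ hdiv _ P⟩
  haveI hSelfin : Finite (W.selmerGroup (p : ℤ)) := W.finite_selmerGroup_holds hn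
  haveI hκfin : Finite κ.range := Finite.of_injective _ (AddSubgroup.inclusion_injective hκle)
  have hidxE : (zsmulAddGroupHom (p : ℤ) : W.toAffine.Point →+ W.toAffine.Point).range.index =
      Nat.card κ.range := by
    rw [← kummerMapTorsion_ker W (p : ℤ) hdiv, AddSubgroup.index_ker]
  -- (1) `[E'(K) : D_v] ≤ ι_v(θ)` and `[E'(K) : B] ≤ ∏ ι_v(θ)`, all non-zero
  have hrange : ∀ v : HeightOneSpectrum (𝓞 K), θκ'.range ≤
      (selmerLocalKer W' (v.adicCompletion K) (p : ℤ)).map (h1Equiv θ hθ).toAddMonoidHom := by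
    rintro v _ ⟨P, rfl⟩
    exact AddSubgroup.mem_map.mpr ⟨κ' P, kummerMapTorsion_mem_selmerLocalKer W' _ hdiv' _ P, rfl⟩
  have hDidx : ∀ v : HeightOneSpectrum (𝓞 K),
      (D v).index ≤ (selmerLocalKer W (v.adicCompletion K) (p : ℤ)).relIndex
          ((selmerLocalKer W' (v.adicCompletion K) (p : ℤ)).map (h1Equiv θ hθ).toAddMonoidHom) ∧
        (D v).index ≠ 0 := by
    intro v
    have hne := (relIndex_map_selmerLocalKer_ne_zero_and_le W W' θ hθ v).1
    rw [hD, AddSubgroup.index_comap]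
    exact ⟨AddSubgroup.relIndex_le_of_le_right (hrange v) hne,
      fun h0 ↦ hne (AddSubgroup.relIndex_eq_zero_of_le_right (hrange v) h0)⟩
  have hBle : B.index ≤ ∏ v ∈ S, (selmerLocalKer W (v.adicCompletion K) (p : ℤ)).relIndex
      ((selmerLocalKer W' (v.adicCompletion K) (p : ℤ)).map (h1Equiv θ hθ).toAddMonoidHom) := by
    refine (AddSubgroup.index_iInf_le _).trans ?_
    rw [← Finset.prod_coe_sort S]
    exact Finset.prod_le_prod' fun v _ ↦ (hDidx v).1
  have hBne : B.index ≠ 0 := AddSubgroup.index_iInf_ne_zero fun v ↦ (hDidx v).2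
  -- (2) `pE'(K) ≤ C` and `[C : pE'(K)] ≤ [E(K) : pE(K)]`
  have hpC : (zsmulAddGroupHom (p : ℤ) : W'.toAffine.Point →+ W'.toAffine.Point).range ≤ C := by
    intro P hP
    rw [← kummerMapTorsion_ker W' (p : ℤ) hdiv'] at hP
    rw [hC, AddMonoidHom.mem_ker, hf_apply, show κ' P = 0 from hP, map_zero, map_zero]
  have hrel : (zsmulAddGroupHom (p : ℤ) : W'.toAffine.Point →+ W'.toAffine.Point).range.relIndex C ≤
      Nat.card κ.range := by
    -- `ψ : C → H¹(K, E[p])`, `P ↦ θ_* κ'(P)`, has kernel `pE'(K)` and image inside `im κ`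
    set ψ : C →+ galH1Torsion W (p : ℤ) := θκ'.comp C.subtype with hψ
    have hψ_apply : ∀ P : C, ψ P = h1Equiv θ hθ (κ' P) := fun P ↦ rfl
    have hψker : ((zsmulAddGroupHom (p : ℤ) :
        W'.toAffine.Point →+ W'.toAffine.Point).range).addSubgroupOf C = ψ.ker := by
      ext P
      rw [AddSubgroup.mem_addSubgroupOf, ← kummerMapTorsion_ker W' (p : ℤ) hdiv',
        AddMonoidHom.mem_ker, AddMonoidHom.mem_ker, hψ_apply,
        map_eq_zero_iff _ (h1Equiv θ hθ).injective]
    have hψle : ψ.range ≤ κ.range := by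
      rintro _ ⟨P, rfl⟩
      rw [hψ_apply]
      have hP : f P = 0 := P.2
      rw [hf_apply] at hP
      exact mem_range_kummerMapTorsion_of_torsionH1ToH1_eq_zero W (p : ℤ) hdiv _ hP
    rw [AddSubgroup.relIndex, hψker, AddSubgroup.index_ker]
    exact Nat.card_le_card_of_injective _ (AddSubgroup.inclusion_injective hψle)
  -- (3) hence `B ⊄ C`
  have hBC : ¬ B ≤ C := by
    intro hle
    have h1 : C.index ≤ B.index :=
      Nat.le_of_dvd (Nat.pos_of_ne_zero hBne) (AddSubgroup.index_dvd_of_le hle)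
    have h2 := AddSubgroup.relIndex_mul_index hpC
    have h3 : (zsmulAddGroupHom (p : ℤ) : W'.toAffine.Point →+ W'.toAffine.Point).range.index ≤
        (zsmulAddGroupHom (p : ℤ) : W.toAffine.Point →+ W.toAffine.Point).range.index *
          ∏ v ∈ S, (selmerLocalKer W (v.adicCompletion K) (p : ℤ)).relIndex
            ((selmerLocalKer W' (v.adicCompletion K) (p : ℤ)).map
              (h1Equiv θ hθ).toAddMonoidHom) := by
      rw [← h2, hidxE]
      exact Nat.mul_le_mul hrel (h1.trans hBle)
    exact absurd hlt (not_lt.mpr h3)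
  obtain ⟨P, hPB, hPC⟩ := SetLike.not_le_iff_exists.mp hBC
  -- (4) the class `c = f(P)` is a non-zero element of `Ш(E/K)[p]`
  set c := f P with hc
  have hpc : p • c = 0 := by
    rw [hc, ← map_nsmul, ← natCast_zsmul]
    exact hpC ⟨P, rfl⟩
  have hsha : c ∈ W.sha := by
    rw [mem_sha_iff]
    refine ⟨fun v ↦ ?_, fun w ↦ ?_⟩
    · rw [hc, hf_apply]
      apply torsionH1ToH1_mem_localRestrictionKer
      by_cases hv : v ∈ S
      · -- `v ∈ S`: `P ∈ B` means `θ_* κ'(P) ∈ 𝓢_v(E)`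
        rw [hB, AddSubgroup.mem_iInf] at hPB
        exact (hD_mem v P).mp (hPB ⟨v, hv⟩)
      · -- `v ∉ S`: good reduction of both curves and `v ∤ p`; Kummer classes are unramified
        obtain ⟨hgood, hgood', hpv⟩ := hS v hv
        have hpv' : ((p : ℤ) : 𝓞 K) ∉ v.asIdeal := by rwa [Int.cast_natCast]
        obtain ⟨𝔓, h𝔓⟩ := v.primesAbove_nonempty
        refine W.unramifiedKer_le_selmerLocalKer hgood hpv' h𝔓 ?_
        rw [← mem_unramifiedKer_iff_h1Equiv_mem, ← W'.selmerLocalKer_eq_unramifiedKer hgood' hpv' h𝔓]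
        exact kummerMapTorsion_mem_selmerLocalKer W' _ hdiv' _ P
    · -- infinite places: `2c ↦ 0` and `pc = 0` with `p` odd
      obtain ⟨k, hk⟩ := hp.odd_of_ne_two hp2
      have h2 := two_nsmul_mem_localRestrictionKer_infinitePlace W w c
      have hck : c = p • c - k • (2 • c) := by
        rw [hk, add_nsmul, one_nsmul, mul_nsmul, add_sub_cancel_left]
      rw [hck, hpc, zero_sub]
      exact neg_mem (AddSubgroup.nsmul_mem _ h2 k)
  refine ⟨⟨c, hsha⟩, fun h ↦ hPC ?_, Subtype.ext hpc⟩
  rw [hC, AddMonoidHom.mem_ker, ← hc]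
  exact congrArg Subtype.val h

/-! ### When is `ι_v(θ) = 1`? -/

omit [NumberField K] [W.IsElliptic] [W'.IsElliptic] [Fact p.Prime] in
/-- **`ι_v(θ) = 1` iff the local Selmer condition of `E'` at `v` transports into that of `E`**:
`[θ_* 𝓢_v(E') : θ_* 𝓢_v(E') ∩ 𝓢_v(E)] = 1 ↔ ∀ c ∈ 𝓢_v(E'), θ_* c ∈ 𝓢_v(E)` (one inclusion of
"the local conditions agree"; stated for an arbitrary `K`-field `L` in place of `K_v`). [folklore] -/
theorem relIndex_map_selmerLocalKer_eq_one_iff {L : Type} [Field L] [Algebra K L] {n : ℤ}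
    (θ : geomTorsion W' n ≃+ geomTorsion W n)
    (hθ : ∀ (σ : absoluteGaloisGroup K) (P : geomTorsion W' n), θ (σ • P) = σ • θ P) :
    (selmerLocalKer W L n).relIndex ((selmerLocalKer W' L n).map (h1Equiv θ hθ).toAddMonoidHom) = 1 ↔
      ∀ c ∈ selmerLocalKer W' L n, h1Equiv θ hθ c ∈ selmerLocalKer W L n := by
  rw [AddSubgroup.relIndex_eq_one, AddSubgroup.map_le_iff_le_comap]
  rfl

omit [Fact p.Prime] in
/-- **Criterion 1: both curves have good reduction at `v ∤ n`.** Then both local conditions are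
"unramified at `v`" (Gross 1991 (7.1) / Milne I.3.8; tree `selmerLocalKer_eq_unramifiedKer`) and
unramifiedness passes through `θ` (`mem_unramifiedKer_iff_h1Equiv_mem`), so `ι_v(θ) = 1`. (Such
places may therefore be put into `S` or left out at no cost.) [cite: GrossLMS1991, §7 (7.1)] -/
theorem relIndex_map_selmerLocalKer_eq_one_of_hasGoodReductionAt {n : ℤ}
    (θ : geomTorsion W' n ≃+ geomTorsion W n)
    (hθ : ∀ (σ : absoluteGaloisGroup K) (P : geomTorsion W' n), θ (σ • P) = σ • θ P)
    {v : HeightOneSpectrum (𝓞 K)} (hgood : W.HasGoodReductionAt v)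
    (hgood' : W'.HasGoodReductionAt v) (hn : (n : 𝓞 K) ∉ v.asIdeal) :
    (selmerLocalKer W (v.adicCompletion K) n).relIndex
        ((selmerLocalKer W' (v.adicCompletion K) n).map (h1Equiv θ hθ).toAddMonoidHom) = 1 := by
  rw [relIndex_map_selmerLocalKer_eq_one_iff]
  intro c hc
  obtain ⟨𝔓, h𝔓⟩ := v.primesAbove_nonempty
  rw [W.selmerLocalKer_eq_unramifiedKer hgood hn h𝔓, ← mem_unramifiedKer_iff_h1Equiv_mem,
    ← W'.selmerLocalKer_eq_unramifiedKer hgood' hn h𝔓]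
  exact hc

omit [W.IsElliptic] [Fact p.Prime] in
/-- **Criterion 2: `E'` has good reduction at `v ∤ n` and the unramified classes of `E[n]` at `v`
satisfy the local condition of `E`** (`unramifiedKer (E[n]) 𝔓 ≤ 𝓢_v(E)` for a prime `𝔓` above
`v`). Then `ι_v(θ) = 1`: `𝓢_v(E') = unramifiedKer (E'[n]) 𝔓` (`selmerLocalKer_eq_unramifiedKer`)
transports into `unramifiedKer (E[n]) 𝔓`. This is the shape met when `E` is obtained from `E'` by
RAISING the level at `v` (then `E[n] ≅ E'[n]` is unramified at `v` although `E` has bad reduction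
there); the hypothesis holds e.g. when `E` too has good reduction at `v`
(`unramifiedKer_le_selmerLocalKer`), and is the statement "`H¹(K_v^nr/K_v, E(K_v^nr))[n] = 0`"
(Milne *ADT* I Prop. 3.8: that group is `H¹(k_v, Φ_v)`, of order the Tamagawa number `c_v(E)`) in
general. [cite: GrossLMS1991, §7 (7.1)] [cite: MilneADT2006, I Prop. 3.8] -/
theorem relIndex_map_selmerLocalKer_eq_one_of_unramifiedKer_le {n : ℤ}
    (θ : geomTorsion W' n ≃+ geomTorsion W n)
    (hθ : ∀ (σ : absoluteGaloisGroup K) (P : geomTorsion W' n), θ (σ • P) = σ • θ P)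
    {v : HeightOneSpectrum (𝓞 K)} (hgood' : W'.HasGoodReductionAt v) (hn : (n : 𝓞 K) ∉ v.asIdeal)
    {𝔓 : Ideal (absIntegers (𝓞 K) K)} (h𝔓 : 𝔓 ∈ v.primesAbove)
    (hur : unramifiedKer (geomTorsion W n) 𝔓 ≤ selmerLocalKer W (v.adicCompletion K) n) :
    (selmerLocalKer W (v.adicCompletion K) n).relIndex
        ((selmerLocalKer W' (v.adicCompletion K) n).map (h1Equiv θ hθ).toAddMonoidHom) = 1 := by
  rw [relIndex_map_selmerLocalKer_eq_one_iff]
  intro c hc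
  refine hur ?_
  rw [← mem_unramifiedKer_iff_h1Equiv_mem, ← W'.selmerLocalKer_eq_unramifiedKer hgood' hn h𝔓]
  exact hc

omit [W.IsElliptic] in
/-- **Criterion 3: `#𝓛_v(E') = 1`** (e.g. `v ∤ p` and `E'(K_v)[p] = 0`, by
`natCard_kummerLocalConditionAt_adicCompletion`). Then `ι_v(θ) = 1`, by
`relIndex_map_selmerLocalKer_ne_zero_and_le`. [folklore] -/
theorem relIndex_map_selmerLocalKer_eq_one_of_natCard_eq_one
    (θ : geomTorsion W' (p : ℤ) ≃+ geomTorsion W (p : ℤ))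
    (hθ : ∀ (σ : absoluteGaloisGroup K) (P : geomTorsion W' (p : ℤ)), θ (σ • P) = σ • θ P)
    {v : HeightOneSpectrum (𝓞 K)}
    (h1 : Nat.card (W'.kummerLocalConditionAt (p : ℤ) (v.adicCompletion K)) = 1) :
    (selmerLocalKer W (v.adicCompletion K) (p : ℤ)).relIndex
        ((selmerLocalKer W' (v.adicCompletion K) (p : ℤ)).map (h1Equiv θ hθ).toAddMonoidHom) = 1 := by
  obtain ⟨hne, hle⟩ := relIndex_map_selmerLocalKer_ne_zero_and_le W W' θ hθ v
  rw [h1] at hle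
  omega

omit [W.IsElliptic] in
/-- Criterion 3 in terms of points: at `v ∤ p` with `E'(K_v)[p] = 0` one has `#𝓛_v(E') = 1`
(`#𝓛_v = #E'(K_v)[p] · #(𝓞_v/p)`, Milne *ADT* I Lemma 3.3), hence `ι_v(θ) = 1`.
[cite: MilneADT2006, I Lemma 3.3] -/
theorem relIndex_map_selmerLocalKer_eq_one_of_card_torsion_eq_one
    (θ : geomTorsion W' (p : ℤ) ≃+ geomTorsion W (p : ℤ))
    (hθ : ∀ (σ : absoluteGaloisGroup K) (P : geomTorsion W' (p : ℤ)), θ (σ • P) = σ • θ P)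
    {v : HeightOneSpectrum (𝓞 K)} (hv : (p : 𝓞 K) ∉ v.asIdeal)
    (hloc : Nat.card (nsmulAddMonoidHom p :
      (W'.baseChange (v.adicCompletion K)).toAffine.Point →+ _).ker = 1) :
    (selmerLocalKer W (v.adicCompletion K) (p : ℤ)).relIndex
        ((selmerLocalKer W' (v.adicCompletion K) (p : ℤ)).map (h1Equiv θ hθ).toAddMonoidHom) = 1 := by
  have hp : p.Prime := Fact.out
  refine relIndex_map_selmerLocalKer_eq_one_of_natCard_eq_one W W' θ hθ ?_
  rw [W'.natCard_kummerLocalConditionAt_adicCompletion v hp.ne_zero, hloc, one_mul,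
    natCard_quot_adicCompletionIntegers_eq_one hv]

/-! ### Hybrid counts -/

/-- **The hybrid count.** With `θ`, `S` as in `exists_sha_ne_zero_of_congr_of_relIndex_lt` and a
subset `T ⊆ S`: if the local conditions agree along `θ` at the places of `S \ T`
(`θ_* 𝓢_v(E') ≤ 𝓢_v(E)`, i.e. `ι_v(θ) = 1`) and
`[E(K) : pE(K)] · ∏_{v ∈ T} #𝓛_v(E') < [E'(K) : pE'(K)]`, then `Ш(E/K)[p] ≠ 0`
(`ι_v(θ) ≤ #𝓛_v(E')` on `T`). With `T = S` this is `exists_sha_ne_zero_of_congr_of_index_lt`.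
[cite: CremonaMazur2000, §3] [cite: AgasheStein2002, Thm. 3.1 and §3.5] -/
theorem exists_sha_ne_zero_of_congr_of_le_off (hp2 : p ≠ 2)
    (θ : geomTorsion W' (p : ℤ) ≃+ geomTorsion W (p : ℤ))
    (hθ : ∀ (σ : absoluteGaloisGroup K) (P : geomTorsion W' (p : ℤ)), θ (σ • P) = σ • θ P)
    (S T : Finset (HeightOneSpectrum (𝓞 K))) (hTS : T ⊆ S)
    (hS : ∀ v : HeightOneSpectrum (𝓞 K), v ∉ S →
      W.HasGoodReductionAt v ∧ W'.HasGoodReductionAt v ∧ (p : 𝓞 K) ∉ v.asIdeal)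
    (hagree : ∀ v ∈ S, v ∉ T → ∀ c ∈ selmerLocalKer W' (v.adicCompletion K) (p : ℤ),
      h1Equiv θ hθ c ∈ selmerLocalKer W (v.adicCompletion K) (p : ℤ))
    (hlt : (zsmulAddGroupHom (p : ℤ) : W.toAffine.Point →+ W.toAffine.Point).range.index *
        ∏ v ∈ T, Nat.card (W'.kummerLocalConditionAt (p : ℤ) (v.adicCompletion K)) <
      (zsmulAddGroupHom (p : ℤ) : W'.toAffine.Point →+ W'.toAffine.Point).range.index) :
    ∃ c : W.sha, c ≠ 0 ∧ p • c = 0 := by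
  refine exists_sha_ne_zero_of_congr_of_relIndex_lt W W' hp2 θ hθ S hS (lt_of_le_of_lt ?_ hlt)
  refine Nat.mul_le_mul_left _ ?_
  rw [← Finset.prod_sdiff hTS]
  rw [Finset.prod_eq_one (s := S \ T) (fun v hv ↦ ?_), one_mul]
  · exact Finset.prod_le_prod' fun v _ ↦ (relIndex_map_selmerLocalKer_ne_zero_and_le W W' θ hθ v).2
  · rw [Finset.mem_sdiff] at hv
    exact (relIndex_map_selmerLocalKer_eq_one_iff W W' θ hθ).mpr (hagree v hv.1 hv.2)

/-- **The shape met in practice, refined: `E(K)` finite of order prime to `p`, agreement of the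
local conditions along `θ` at every place of `S` above `p` and at every place of `S` where `E'` has
`K_v`-rational `p`-torsion, and `rank E'(K) ≥ 1`** ⇒ `Ш(E/K)[p] ≠ 0`. Indeed with
`T = {v ∈ S : v ∤ p, E'(K_v)[p] = 0}` every factor is `1` (`ι_v = 1` off `T` by hypothesis,
`#𝓛_v(E') = #E'(K_v)[p] · #(𝓞_v/p) = 1` on `T`), `[E(K) : pE(K)] = 1` and
`[E'(K) : pE'(K)] ≥ p^{rank E'(K)} ≥ p > 1`. Compare `exists_sha_ne_zero_of_congr_of_rank` (no
agreement used: `E'(K_v)[p] = 0` on all of `S` and `rank E'(K) ≥ [K:ℚ] + 1`). Over `ℚ` with `E`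
of rank `0` and `E'` a `p`-congruent curve: the places to be checked are `p` itself and the bad
places `ℓ` with `E'(ℚ_ℓ)[p] ≠ 0`; the companion file `CongruenceVisibilityMultiplicative.lean`
discharges the agreement at places where both curves have split multiplicative reduction.
[cite: CremonaMazur2000, §3 and Table 1] [cite: AgasheStein2002, Thm. 3.1 and §3.5] -/
theorem exists_sha_ne_zero_of_congr_of_rank_of_le (hp2 : p ≠ 2)
    (θ : geomTorsion W' (p : ℤ) ≃+ geomTorsion W (p : ℤ))
    (hθ : ∀ (σ : absoluteGaloisGroup K) (P : geomTorsion W' (p : ℤ)), θ (σ • P) = σ • θ P)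
    (S : Finset (HeightOneSpectrum (𝓞 K)))
    (hS : ∀ v : HeightOneSpectrum (𝓞 K), v ∉ S →
      W.HasGoodReductionAt v ∧ W'.HasGoodReductionAt v ∧ (p : 𝓞 K) ∉ v.asIdeal)
    (hfin : Finite W.toAffine.Point) (hcop : (Nat.card W.toAffine.Point).Coprime p)
    (hrank : 1 ≤ W'.mordellWeilRank)
    (hagree : ∀ v ∈ S, ((p : 𝓞 K) ∈ v.asIdeal ∨ Nat.card (nsmulAddMonoidHom p :
        (W'.baseChange (v.adicCompletion K)).toAffine.Point →+ _).ker ≠ 1) →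
      ∀ c ∈ selmerLocalKer W' (v.adicCompletion K) (p : ℤ),
        h1Equiv θ hθ c ∈ selmerLocalKer W (v.adicCompletion K) (p : ℤ)) :
    ∃ c : W.sha, c ≠ 0 ∧ p • c = 0 := by
  have hp : p.Prime := Fact.out
  classical
  set T := S.filter (fun v ↦ (p : 𝓞 K) ∉ v.asIdeal ∧ Nat.card (nsmulAddMonoidHom p :
      (W'.baseChange (v.adicCompletion K)).toAffine.Point →+ _).ker = 1) with hT
  refine exists_sha_ne_zero_of_congr_of_le_off W W' hp2 θ hθ S T (Finset.filter_subset _ _) hS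
    (fun v hv hvT ↦ hagree v hv ?_) ?_
  · by_contra hcon
    rw [not_or, not_not] at hcon
    exact hvT (Finset.mem_filter.mpr ⟨hv, hcon⟩)
  · rw [index_range_zsmul_eq_one_of_coprime hcop, one_mul,
      Finset.prod_eq_one (fun v hv ↦ ?_)]
    · calc (1 : ℕ) < p ^ 1 := by rw [pow_one]; exact hp.one_lt
        _ ≤ p ^ W'.mordellWeilRank := Nat.pow_le_pow_right hp.pos hrank
        _ ≤ _ := pow_mordellWeilRank_le_index_range_zsmul W' hp.ne_zero
    · rw [hT, Finset.mem_filter] at hv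
      rw [W'.natCard_kummerLocalConditionAt_adicCompletion v hp.ne_zero, hv.2.2, one_mul,
        natCard_quot_adicCompletionIntegers_eq_one hv.2.1]

end Main

end WeierstrassCurve

end
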